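import Summits.CriticalPhenomena.Ising3DConformalLimit.Theses.LogPolarProxy
import HarnessLib

/-!
# Vocabulary of crux `ProxyUniversality` (stmt-CriticalPhenomena-11288), route `LogPolarProxy`:
# the finite log-polar proxy, named

Route `LogPolarProxy` (sub-problem `CriticalPhenomena/Ising3DConformalLimit`), crux
`Summit.CriticalPhenomena.Ising3DConformalLimit.Theses.LogPolarProxy.ProxyUniversality`, checked skeleton
`Cruxes/ProxyUniversality/Lines/birth.lean` (line `registered`, lead `prover-line-stmt-CriticalPhenomena-11288-0`).
This is the **definitions module** of that skeleton (the route's definition request (1),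
"`logPolarIsingCorr` … plus `v_N` and `c_N` as named functions, in a LIGHT file"): it names, sorry-free and
VERBATIM from the inlined term of the route decl, the objects of the crux —

* `Idx N` — the index set of the resolution-`N` log-polar grid (radial shell `i ∈ Fin (2M+1)`,
  `M = (N+1)²`; polar row `j ∈ Fin (N+1)`; azimuth `k ∈ Fin (2N+2)`), mesh `δ_N = π/(N+1)`;
* `vertex N x` — `v_N(x)`, the grid vertex of `x ∈ ℝ³ ∖ (z-axis)` in log-polar coordinates;
* `coupling Jr Jt Jp N a b` — `c_N(a,b)`, the row-dependent nearest-neighbour pair couplings;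
* `proxyAvg Jr Jt Jp N n p` — `⟨∏ᵢ σ_{v_N(pᵢ)}⟩_{c_N}`, the free-b.c. finite Gibbs average of the spin
  monomial, written out over `spinAt` exactly as in the crux (it is Literature's `PairIsing.avg c_N …` by
  `rfl`, deliberately not imported — cone hygiene of the route, rev 2);
* `weight A ρ N n p` — the local multiplicative renormalisation `∏ᵢ A_N(θ(pᵢ)) ρ(δ_N‖pᵢ‖)`;
* `proxyCorr` — `weight · proxyAvg`, the renormalised proxy correlator; `offAxis n` — the convergence
  domain (injective configurations off the `z`-axis);

records `proxyUniversality_iff : ProxyUniversality ↔ <the statement over the named objects> := Iff.rfl`,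
and proves the elementary, profile-independent facts every prover of the crux needs: the Gibbs
denominator is positive, `|proxyAvg| ≤ 1`, the empty monomial has average `1` (`n = 0`), odd monomials
have average `0` (global spin flip `σ ↦ -σ`, free boundary condition, no field), hence
`proxyCorr … N 0 = 1` and `proxyCorr … N n = 0` for odd `n`; and the topology of `offAxis n` (open, inside
`NonCoincident 3 n`, norms positive). Nothing here is asserted about the crux.

Sources: R. C. Brower, G. T. Fleming, H. Neuberger, Phys. Lett. B 721 (2013) (radial lattice
quantisation) [BrowerFlemingNeuberger2013]; S. Friedli, Y. Velenik, *Statistical Mechanics of Lattice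
Systems* (CUP 2017) §3.7.1 (spin-flip symmetry) [FriedliVelenik2017].
-/

noncomputable section

namespace Summit.CriticalPhenomena.Ising3DConformalLimit.Cruxes.ProxyUniversality.Birth

open scoped BigOperators Topology Classical
open Filter Set Function
open Literature.Probability.LatticeModels
open Summit.CriticalPhenomena.Ising3DConformalLimit.Theses.LogPolarProxy (ProxyUniversality)

/-! ## The finite log-polar proxy, named (definitionally the inlined term of the crux) -/

/-- Index set of the resolution-`N` log-polar grid: radial shell `i ∈ Fin (2M+1)`, `M = (N+1)²`,
polar row `j ∈ Fin (N+1)`, azimuth `k ∈ Fin (2N+2)`. -/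
abbrev Idx (N : ℕ) : Type := Fin (2 * (N + 1) ^ 2 + 1) × Fin (N + 1) × Fin (2 * N + 2)

/-- `v_N(x)`: the grid vertex nearest to `x ∈ ℝ³ ∖ (z-axis)` in log-polar coordinates
(`δ = π/(N+1)`, `M = (N+1)²`): `(round(log‖x‖/δ) + M, ⌊θ/δ⌋, ⌊φ/δ⌋ mod 2N+2)`, clamped. -/
def vertex (N : ℕ) (x : EuclideanSpace ℝ (Fin 3)) : Idx N :=
  (⟨min (2 * (N + 1) ^ 2) (Int.toNat (round (Real.log ‖x‖ / (Real.pi / (N + 1))) + (N + 1) ^ 2)),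
      Nat.lt_add_one_of_le (min_le_left _ _)⟩,
    ⟨min N (Int.toNat ⌊Real.arccos (x 2 / ‖x‖) / (Real.pi / (N + 1))⌋),
      Nat.lt_add_one_of_le (min_le_left _ _)⟩,
    ⟨Int.toNat (⌊Complex.arg ⟨x 0, x 1⟩ / (Real.pi / (N + 1))⌋ + (2 * N + 2)) % (2 * N + 2),
      Nat.mod_lt _ (Nat.succ_pos _)⟩)

/-- `c_N(a,b)`: the row-dependent nearest-neighbour pair couplings of the proxy — `J_r N j` on radial
edges, `J_θ N (min j j')` on polar edges, `J_φ N j` on azimuthal edges (periodic in `k`), `0` otherwise. -/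
def coupling (Jr Jt Jp : ℕ → ℕ → ℝ) (N : ℕ) (a b : Idx N) : ℝ :=
  if a.2.1 = b.2.1 ∧ a.2.2 = b.2.2 ∧ (a.1.val + 1 = b.1.val ∨ b.1.val + 1 = a.1.val) then Jr N a.2.1.val
  else if a.1 = b.1 ∧ a.2.2 = b.2.2 ∧ (a.2.1.val + 1 = b.2.1.val ∨ b.2.1.val + 1 = a.2.1.val) then
    Jt N (min a.2.1.val b.2.1.val)
  else if a.1 = b.1 ∧ a.2.1 = b.2.1 ∧ (a.2.2.val + 1 = b.2.2.val ∨ b.2.2.val + 1 = a.2.2.val ∨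
      (a.2.2.val = 0 ∧ b.2.2.val = 2 * N + 1) ∨ (b.2.2.val = 0 ∧ a.2.2.val = 2 * N + 1)) then Jp N a.2.1.val
  else 0

/-- The free-b.c. Gibbs weight `exp(Σ_a Σ_b c_N(a,b) σ_a σ_b)` of a proxy configuration (ordered pairs,
so each edge is counted twice; no field). -/
def gibbsWeight (Jr Jt Jp : ℕ → ℕ → ℝ) (N : ℕ) (σ : Idx N → ℤˣ) : ℝ :=
  Real.exp (∑ a : Idx N, ∑ b : Idx N, coupling Jr Jt Jp N a b * (spinAt a σ * spinAt b σ))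

/-- `⟨∏ᵢ σ_{v_N(pᵢ)}⟩_{c_N}`: the free-b.c. finite Gibbs average of the spin monomial at the grid
vertices of `p`, written out over `spinAt` exactly as in the crux (`= PairIsing.avg c_N …` by `rfl`). -/
def proxyAvg (Jr Jt Jp : ℕ → ℕ → ℝ) (N n : ℕ)
    (p : Fin n → EuclideanSpace ℝ (Fin 3)) : ℝ :=
  (∑ σ : Idx N → ℤˣ, (spinMonomial fun i : Fin n => vertex N (p i)) σ *
      Real.exp (∑ a : Idx N, ∑ b : Idx N, coupling Jr Jt Jp N a b * (spinAt a σ * spinAt b σ))) /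
    ∑ σ : Idx N → ℤˣ,
      Real.exp (∑ a : Idx N, ∑ b : Idx N, coupling Jr Jt Jp N a b * (spinAt a σ * spinAt b σ))

/-- The local multiplicative renormalisation `∏ᵢ A_N(θ(pᵢ)) · ρ(δ_N ‖pᵢ‖)`, `δ_N = π/(N+1)`. -/
def weight (A : ℕ → ℝ → ℝ) (ρ : ℝ → ℝ) (N n : ℕ)
    (p : Fin n → EuclideanSpace ℝ (Fin 3)) : ℝ :=
  ∏ i : Fin n, A N (Real.arccos (p i 2 / ‖p i‖)) * ρ (Real.pi / (N + 1) * ‖p i‖)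

/-- The renormalised proxy correlator of the crux: `weight · proxyAvg`. -/
def proxyCorr (Jr Jt Jp : ℕ → ℕ → ℝ) (A : ℕ → ℝ → ℝ) (ρ : ℝ → ℝ) (N n : ℕ)
    (p : Fin n → EuclideanSpace ℝ (Fin 3)) : ℝ :=
  weight A ρ N n p * proxyAvg Jr Jt Jp N n p

/-- The convergence domain of the crux: injective configurations with every point off the `z`-axis. -/
def offAxis (n : ℕ) : Set (Fin n → EuclideanSpace ℝ (Fin 3)) :=
  {p : Fin n → EuclideanSpace ℝ (Fin 3) | Function.Injective p ∧ ∀ i, ¬ (p i 0 = 0 ∧ p i 1 = 0)}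

/-- The route decl `LogPolarProxy.ProxyUniversality` IS the statement over the named objects
(`proxyCorr`, `offAxis`), definitionally (`Iff.rfl`). -/
theorem proxyUniversality_iff :
    ProxyUniversality ↔
      ∀ (ρ : ℝ → ℝ) (S : CorrFamily 3), (∀ δ ∈ Set.Ioc (0:ℝ) 1, 0 < ρ δ) →
        HasPointwiseScalingLimit (criticalCorr 3) ρ S → IsNondegenerateTwoPoint S →
        ∃ (Jr Jt Jp : ℕ → ℕ → ℝ) (A : ℕ → ℝ → ℝ), (∀ N j, 0 ≤ Jr N j ∧ 0 ≤ Jt N j ∧ 0 ≤ Jp N j) ∧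
          (∀ N θ, 0 < A N θ) ∧
          ∀ n : ℕ, TendstoLocallyUniformlyOn (fun N : ℕ => proxyCorr Jr Jt Jp A ρ N n) (S n) atTop
            (offAxis n) :=
  Iff.rfl

/-! ## Elementary, profile-independent properties of the proxy average -/

section ProxyAvg

variable (Jr Jt Jp : ℕ → ℕ → ℝ) (N : ℕ)

/-- `proxyAvg` is the quotient `(Σ_σ monomial · gibbsWeight) / (Σ_σ gibbsWeight)` (by `rfl`). -/
theorem proxyAvg_eq (n : ℕ) (p : Fin n → EuclideanSpace ℝ (Fin 3)) :
    proxyAvg Jr Jt Jp N n p =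
      (∑ σ : Idx N → ℤˣ, (spinMonomial fun i : Fin n => vertex N (p i)) σ * gibbsWeight Jr Jt Jp N σ) /
        ∑ σ : Idx N → ℤˣ, gibbsWeight Jr Jt Jp N σ := rfl

/-- The Gibbs weight is positive. -/
theorem gibbsWeight_pos (σ : Idx N → ℤˣ) : 0 < gibbsWeight Jr Jt Jp N σ := Real.exp_pos _

/-- The Gibbs weight is invariant under the global spin flip `σ ↦ -σ` (no field, pair interaction). -/
theorem gibbsWeight_neg (σ : Idx N → ℤˣ) : gibbsWeight Jr Jt Jp N (-σ) = gibbsWeight Jr Jt Jp N σ := by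
  simp only [gibbsWeight, spinAt_neg, neg_mul_neg]

/-- The partition function `Σ_σ gibbsWeight σ` of the proxy is positive. -/
theorem sum_gibbsWeight_pos : 0 < ∑ σ : Idx N → ℤˣ, gibbsWeight Jr Jt Jp N σ :=
  Finset.sum_pos (fun σ _ => gibbsWeight_pos Jr Jt Jp N σ) Finset.univ_nonempty

/-- A spin monomial has modulus `1`. -/
theorem abs_spinMonomial_eq_one {V : Type*} {n : ℕ} (x : Fin n → V) (σ : SpinConfig V) :
    |spinMonomial x σ| = 1 := by
  simp [spinMonomial, Finset.abs_prod]

/-- A spin monomial changes by the sign `(-1)^n` under the global spin flip. -/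
theorem spinMonomial_neg {V : Type*} {n : ℕ} (x : Fin n → V) (σ : SpinConfig V) :
    spinMonomial x (-σ) = (-1) ^ n * spinMonomial x σ := by
  simp only [spinMonomial, spinAt_neg]
  rw [Finset.prod_neg, Finset.card_univ, Fintype.card_fin]

/-- **`|⟨∏ σ⟩_{c_N}| ≤ 1`**: a Gibbs average of a `±1`-valued observable has modulus at most `1`. -/
theorem abs_proxyAvg_le_one (n : ℕ) (p : Fin n → EuclideanSpace ℝ (Fin 3)) :
    |proxyAvg Jr Jt Jp N n p| ≤ 1 := by
  rw [proxyAvg_eq, abs_div, abs_of_pos (sum_gibbsWeight_pos Jr Jt Jp N),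
    div_le_one (sum_gibbsWeight_pos Jr Jt Jp N)]
  refine (Finset.abs_sum_le_sum_abs _ _).trans (Finset.sum_le_sum fun σ _ => ?_)
  rw [abs_mul, abs_spinMonomial_eq_one, one_mul, abs_of_pos (gibbsWeight_pos Jr Jt Jp N σ)]

/-- **`n = 0`: the average of the empty monomial is `1`** (numerator = denominator = partition function). -/
theorem proxyAvg_zero (p : Fin 0 → EuclideanSpace ℝ (Fin 3)) : proxyAvg Jr Jt Jp N 0 p = 1 := by
  rw [proxyAvg_eq]
  have h : ∀ σ : Idx N → ℤˣ, (spinMonomial fun i : Fin 0 => vertex N (p i)) σ = 1 := fun σ => by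
    simp [spinMonomial]
  simp only [h, one_mul]
  exact div_self (sum_gibbsWeight_pos Jr Jt Jp N).ne'

/-- **Odd `n`: the average of an odd spin monomial vanishes** for EVERY coupling profile and every
resolution — the global spin flip `σ ↦ -σ` preserves the free-b.c. pair-interaction weight and reverses
the sign of the monomial (Friedli–Velenik 2017, §3.7.1). -/
theorem proxyAvg_eq_zero_of_odd {n : ℕ} (hn : Odd n) (p : Fin n → EuclideanSpace ℝ (Fin 3)) :
    proxyAvg Jr Jt Jp N n p = 0 := by
  rw [proxyAvg_eq, div_eq_zero_iff]
  left
  set x : Fin n → Idx N := fun i => vertex N (p i)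
  have hflip : ∑ σ : Idx N → ℤˣ, spinMonomial x σ * gibbsWeight Jr Jt Jp N σ =
      ∑ σ : Idx N → ℤˣ, spinMonomial x (-σ) * gibbsWeight Jr Jt Jp N (-σ) :=
    (Fintype.sum_equiv (Equiv.neg (Idx N → ℤˣ)) _ _ fun σ => rfl).symm
  have hneg : ∑ σ : Idx N → ℤˣ, spinMonomial x (-σ) * gibbsWeight Jr Jt Jp N (-σ) =
      -∑ σ : Idx N → ℤˣ, spinMonomial x σ * gibbsWeight Jr Jt Jp N σ := by
    rw [← Finset.sum_neg_distrib]
    refine Finset.sum_congr rfl fun σ _ => ?_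
    rw [spinMonomial_neg, gibbsWeight_neg, hn.neg_one_pow]
    ring
  linarith [hflip.trans hneg]

end ProxyAvg

/-! ## Consequences for the renormalised correlator -/

/-- At `n = 0` the weight is the empty product `1`. -/
theorem weight_zero (A : ℕ → ℝ → ℝ) (ρ : ℝ → ℝ) (N : ℕ) (p : Fin 0 → EuclideanSpace ℝ (Fin 3)) :
    weight A ρ N 0 p = 1 := by
  simp [weight]

/-- **`n = 0`: the renormalised proxy correlator is identically `1`**, for every profile, amplitude and
renormalisation. -/
theorem proxyCorr_zero (Jr Jt Jp : ℕ → ℕ → ℝ) (A : ℕ → ℝ → ℝ) (ρ : ℝ → ℝ) (N : ℕ)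
    (p : Fin 0 → EuclideanSpace ℝ (Fin 3)) : proxyCorr Jr Jt Jp A ρ N 0 p = 1 := by
  rw [proxyCorr, weight_zero, proxyAvg_zero, one_mul]

/-- **Odd `n`: the renormalised proxy correlator is identically `0`**, for every profile, amplitude and
renormalisation. -/
theorem proxyCorr_eq_zero_of_odd (Jr Jt Jp : ℕ → ℕ → ℝ) (A : ℕ → ℝ → ℝ) (ρ : ℝ → ℝ) (N : ℕ) {n : ℕ}
    (hn : Odd n) (p : Fin n → EuclideanSpace ℝ (Fin 3)) : proxyCorr Jr Jt Jp A ρ N n p = 0 := by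
  rw [proxyCorr, proxyAvg_eq_zero_of_odd Jr Jt Jp N hn, mul_zero]

/-! ## The convergence domain `offAxis n` -/

/-- `offAxis n ⊆ NonCoincident 3 n` (injective configurations). -/
theorem offAxis_subset_nonCoincident (n : ℕ) : offAxis n ⊆ NonCoincident 3 n := fun _ hp => hp.1

/-- Off the `z`-axis every point is nonzero. -/
theorem norm_pos_of_mem_offAxis {n : ℕ} {p : Fin n → EuclideanSpace ℝ (Fin 3)}
    (hp : p ∈ offAxis n) (i : Fin n) : 0 < ‖p i‖ := by
  rcases hp with ⟨-, hp⟩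
  refine norm_pos_iff.2 fun h => hp i ?_
  simp [h]

/-- `offAxis n` is open: injectivity is an open condition (`isOpen_nonCoincident`) and so is
`¬ (pᵢ₀ = 0 ∧ pᵢ₁ = 0)` for each `i` (complement of the zero set of two continuous coordinates). -/
theorem isOpen_offAxis (n : ℕ) : IsOpen (offAxis n) := by
  have h1 : IsOpen {p : Fin n → EuclideanSpace ℝ (Fin 3) | Function.Injective p} :=
    isOpen_nonCoincident 3 n
  have h2 : IsOpen {p : Fin n → EuclideanSpace ℝ (Fin 3) | ∀ i, ¬ (p i 0 = 0 ∧ p i 1 = 0)} := by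
    rw [Set.setOf_forall]
    refine isOpen_iInter_of_finite fun i => ?_
    have hc0 : Continuous fun p : Fin n → EuclideanSpace ℝ (Fin 3) => p i 0 :=
      (EuclideanSpace.proj (0 : Fin 3)).continuous.comp (continuous_apply i)
    have hc1 : Continuous fun p : Fin n → EuclideanSpace ℝ (Fin 3) => p i 1 :=
      (EuclideanSpace.proj (1 : Fin 3)).continuous.comp (continuous_apply i)
    have : {p : Fin n → EuclideanSpace ℝ (Fin 3) | ¬ (p i 0 = 0 ∧ p i 1 = 0)} =
        ({p | p i 0 = 0} ∩ {p | p i 1 = 0})ᶜ := by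
      ext p; simp [Set.mem_compl_iff, not_and]
    rw [this]
    exact ((isClosed_eq hc0 continuous_const).inter (isClosed_eq hc1 continuous_const)).isOpen_compl
  exact h1.inter h2

/-- A point of `offAxis n` has an `offAxis n`-neighbourhood which is a neighbourhood: `𝓝[offAxis n] x = 𝓝 x`
there. -/
theorem nhdsWithin_offAxis_eq {n : ℕ} {x : Fin n → EuclideanSpace ℝ (Fin 3)} (hx : x ∈ offAxis n) :
    𝓝[offAxis n] x = 𝓝 x :=
  (isOpen_offAxis n).nhdsWithin_eq hx

end Summit.CriticalPhenomena.Ising3DConformalLimit.Cruxes.ProxyUniversality.Birth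

end
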